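import Mathlib
import Summits.Ventures.PercRepro.TriangleCapTwoTrianglesC

/-!
# PercRepro — towards the cell `(7, 11)`: counting helpers for the three-triangle case (p3, gen 35; part 35k)

* `four_le_sum_codeg_zero_pairs` — two vertex-disjoint `codeg = 0` pairs with positive deficits: `Σ₀ ≥ 4`;
* `seven_mem` — seven distinct vertices of a `7`-vertex graph are all of them;
* `not_eight` — eight distinct vertices do not fit in `7`.

Axioms: standard.
-/

namespace PercRepro

namespace TriangleCap

namespace C047

open Finset

variable {V : Type*} [Fintype V] [DecidableEq V]

/-- Two vertex-disjoint `codeg = 0` pairs with positive deficits give `Σ_{codeg = 0} deficit ≥ 4`. -/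
theorem four_le_sum_codeg_zero_pairs (D : SimpleGraph V) [DecidableRel D.Adj] {p₁ q₁ p₂ q₂ : V}
    (h12 : p₁ ≠ p₂) (h1q : p₁ ≠ q₂) (hq1 : q₁ ≠ p₂) (hqq : q₁ ≠ q₂) (h1 : D.Adj p₁ q₁) (h2 : D.Adj p₂ q₂)
    (hc₁ : codeg D (p₁, q₁) = 0) (hc₂ : codeg D (p₂, q₂) = 0) (hd₁ : 1 ≤ deficit D (p₁, q₁))
    (hd₂ : 1 ≤ deficit D (p₂, q₂)) :
    4 ≤ ∑ p ∈ adjPairsAll D, (if codeg D p = 0 then deficit D p else 0) := by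
  set P : Finset (V × V) := {(p₁, q₁), (q₁, p₁), (p₂, q₂), (q₂, p₂)} with hP
  have hsub : P ⊆ adjPairsAll D := by
    intro p hp
    rw [hP] at hp
    simp only [mem_insert, mem_singleton] at hp
    rw [mem_adjPairsAll]
    rcases hp with rfl | rfl | rfl | rfl
    · exact h1
    · exact h1.symm
    · exact h2
    · exact h2.symm
  have hc₁' : codeg D (q₁, p₁) = 0 := by rw [codeg_comm]; exact hc₁
  have hc₂' : codeg D (q₂, p₂) = 0 := by rw [codeg_comm]; exact hc₂
  have hd₁' : 1 ≤ deficit D (q₁, p₁) := by rw [deficit_comm]; exact hd₁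
  have hd₂' : 1 ≤ deficit D (q₂, p₂) := by rw [deficit_comm]; exact hd₂
  have hpos : ∀ p ∈ P, 1 ≤ (if codeg D p = 0 then deficit D p else 0) := by
    intro p hp
    rw [hP] at hp
    simp only [mem_insert, mem_singleton] at hp
    rcases hp with rfl | rfl | rfl | rfl
    · rw [if_pos hc₁]; exact hd₁
    · rw [if_pos hc₁']; exact hd₁'
    · rw [if_pos hc₂]; exact hd₂
    · rw [if_pos hc₂']; exact hd₂'
  have hcard : P.card = 4 := by
    rw [hP, card_insert_of_notMem, card_insert_of_notMem, card_insert_of_notMem, card_singleton]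
    all_goals simp [h1.ne, h2.ne, h1.ne.symm, h2.ne.symm, h12, h1q, hq1, hqq]
  calc 4 = ∑ _p ∈ P, 1 := by rw [sum_const, hcard]; rfl
    _ ≤ ∑ p ∈ P, (if codeg D p = 0 then deficit D p else 0) := sum_le_sum hpos
    _ ≤ ∑ p ∈ adjPairsAll D, (if codeg D p = 0 then deficit D p else 0) := sum_le_sum_of_subset hsub

/-- Seven pairwise distinct vertices of a `7`-vertex graph are all of them. -/
theorem seven_mem (hk : Fintype.card V = 7) {v₁ v₂ v₃ v₄ v₅ v₆ v₇ : V}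
    (h : ({v₁, v₂, v₃, v₄, v₅, v₆, v₇} : Finset V).card = 7) (t : V) :
    t = v₁ ∨ t = v₂ ∨ t = v₃ ∨ t = v₄ ∨ t = v₅ ∨ t = v₆ ∨ t = v₇ := by
  have hu : ({v₁, v₂, v₃, v₄, v₅, v₆, v₇} : Finset V) = univ := eq_univ_of_card _ (by rw [h, hk])
  have ht : t ∈ ({v₁, v₂, v₃, v₄, v₅, v₆, v₇} : Finset V) := by rw [hu]; exact mem_univ t
  simpa only [mem_insert, mem_singleton] using ht

/-- Eight pairwise distinct vertices do not fit in a `7`-vertex graph. -/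
theorem not_eight (hk : Fintype.card V = 7) {v₁ v₂ v₃ v₄ v₅ v₆ v₇ v₈ : V}
    (h : ({v₁, v₂, v₃, v₄, v₅, v₆, v₇, v₈} : Finset V).card = 8) : False := by
  have := card_le_univ ({v₁, v₂, v₃, v₄, v₅, v₆, v₇, v₈} : Finset V)
  rw [h, hk] at this
  omega

end C047

end TriangleCap

end PercRepro
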